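import Literature.Analysis.FluidPDE.LerayResolvedEnergyProofs
import Literature.Analysis.FluidPDE.OnsagerCCFSFluxEstimateProofs
import Literature.Analysis.FluidPDE.CoarseGrainingEstimates
import Literature.Analysis.FluidPDE.NSHopfEnergy
import Literature.Analysis.FunctionSpaces.TorusSobolevL4
import Literature.Analysis.FluidPDE.DissipationAnomalyProofs
import Literature.Analysis.FluidPDE.LerayHopfSpectralMeasurability
import HarnessLib

/-!
# Solo (informed) — W11a: the resolved-energy window inequality at a FIXED scale, energy class only

First half of W11 (the long-time flux floor, `SoloInformedFluxFloor`).  For a Leray–Hopf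
solution of forced Navier–Stokes on `T^d × [0,T]` (`2 ≤ d ≤ 4`) we prove, with NO regularity
hypothesis beyond the Leray–Hopf energy class:

* `lerayHopfOn_lintegral_enorm_pow_three_lt_top` — `u ∈ L³ₜL³ₓ` (Cauchy–Schwarz
  `∫|u|³ ≤ ‖u‖₂‖u‖₄²` and the embedding `H¹ ⊂ L⁴`, `Torus.lintegral_enorm_pow_four_le_eSobolevNorm`),
  which discharges the `L³` hypothesis of the resolved energy balance
  `Torus.IsLerayHopfOn.resolvedEnergyBalance_holds` (Drivas–Eyink 2019, Lemma 2);
* `lerayHopfOn_ofReal_integral_abs_cetFlux_le` — the time-integrated Constantin–E–Titi flux at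
  scale `ℓ` is at most `C ∫₀ᵀ ω(u(t); ℓ)³ dt` in `[0, ∞]`, where
  `ω(v; ℓ) = sup_{0<‖y‖≤ℓ} ‖v(· + y) - v‖_{L³}/‖y‖^{1/3}` (`eLocDiffModulus (1/3) 3 v volume ℓ`, so
  `ω(v; ℓ)³ = sup_{0<‖y‖≤ℓ} S₃^{abs}(v; y)/‖y‖` is the compensated absolute third-order structure
  function over scales `≤ ℓ`) and `C` is any constant of the CCFS local flux estimate
  (`Torus.abs_cetFlux_le_eLocDiffModulus_holds`, CCFS 2008 (13)–(18));
* `lerayHopfOn_dissipation_le_fixedScale` — the window inequality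
  `ν∫₀ᵀ‖∇u‖₂² ≤ E(u₀) + ∫₀ᵀ|Π_ℓ[u]| + (ν·4d²C₁²/ℓ² + 2dA_f/λ)∫₀ᵀ‖u‖₂² + 2dA_fλT`
  for every `0 < ℓ ≤ 1/4`, `λ > 0`, with `A_f` the `L²` translation modulus of the force at scale
  `ℓ` (the large-scale cumulants are bounded by the ENERGY, not by a Besov norm);

Nearest prior art: the barrier `Literature.Barriers.AnomalousDissipation.OnsagerSingularityLeray`
(Drivas–Eyink 2019, Lemma 1: fixed window, Besov-uniform hypothesis, `ℓ = ν^{1/(σ+1)} → 0`);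
here the scale is fixed and no Besov hypothesis is made.
-/

open MeasureTheory Filter Topology Set Function
open scoped ENNReal NNReal InnerProductSpace RealInnerProductSpace

namespace Summit.AnomalousDissipation.AnomalousDissipation.Theorems

open Literature.Analysis Literature.Analysis.FunctionSpaces Literature.Analysis.FluidPDE

variable {d : Type*} [Fintype d] [DecidableEq d]

/-! ## Slice lemmas -/

omit [DecidableEq d] in
/-- `‖v(· - y) - v‖_{Lᵖ} ≤ 2‖v‖_{Lᵖ}` on `T^d`: the trivial translation modulus of an `Lᵖ` field
(triangle inequality and translation invariance of Haar measure). [folklore] -/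
theorem eLpNorm_shift_sub_le {E' : Type*} [NormedAddCommGroup E'] {v : UnitAddTorus d → E'}
    {p : ℝ≥0∞} (hp : 1 ≤ p) (hv : AEStronglyMeasurable v volume) (y : UnitAddTorus d) :
    eLpNorm (fun x => v (x - y) - v x) p volume ≤ 2 * eLpNorm v p volume := by
  have hmp := measurePreserving_sub_right (volume : Measure (UnitAddTorus d)) y
  have hvy : AEStronglyMeasurable (fun x => v (x - y)) volume := hv.comp_measurePreserving hmp
  calc eLpNorm (fun x => v (x - y) - v x) p volume
      ≤ eLpNorm (fun x => v (x - y)) p volume + eLpNorm v p volume := eLpNorm_sub_le hvy hv hp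
    _ = 2 * eLpNorm v p volume := by
        rw [show (fun x => v (x - y)) = v ∘ fun x => x - y from rfl,
          eLpNorm_comp_measurePreserving hv hmp, two_mul]

/-- **`L³` control of an energy-class field in dimension `≤ 4`, linear in `‖∇v‖₂²`**: there is
`K = K(d)` with `∫‖v‖³ ≤ K^{1/2} (∫‖v‖²)^{1/2} (∫‖v‖² + ‖∇v‖₂²)` for every `v ∈ L²(T^d; ℝ^d)`
(Cauchy–Schwarz `∫|v|·|v|² ≤ ‖v‖₂‖v‖₄²`, the embedding `H¹ ⊂ L⁴`
`Torus.lintegral_enorm_pow_four_le_eSobolevNorm` and `‖v‖²_{H¹} ≤ ∫‖v‖² + ‖∇v‖₂²`). [folklore] -/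
theorem exists_lintegral_enorm_pow_three_le (hd2 : 2 ≤ Fintype.card d) (hd4 : Fintype.card d ≤ 4) :
    ∃ K : ℝ≥0, ∀ v : UnitAddTorus d → EuclideanSpace ℝ d, MemLp v 2 volume →
      ∫⁻ x, ‖v x‖ₑ ^ 3 ≤ (K : ℝ≥0∞) ^ (1 / 2 : ℝ) * (∫⁻ x, ‖v x‖ₑ ^ 2) ^ (1 / 2 : ℝ) *
        ((∫⁻ x, ‖v x‖ₑ ^ 2) + Torus.eGradNormSq v) := by
  obtain ⟨K, hK⟩ := Torus.lintegral_enorm_pow_four_le_eSobolevNorm hd2 hd4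
  refine ⟨K, fun v hv => ?_⟩
  set A : ℝ≥0∞ := ∫⁻ x, ‖v x‖ₑ ^ 2 with hA
  set G : ℝ≥0∞ := Torus.eGradNormSq v with hG
  have hm : AEMeasurable (fun x => ‖v x‖ₑ) volume := hv.1.enorm
  have hCS := ENNReal.lintegral_mul_le_Lp_mul_Lq volume Real.HolderConjugate.two_two hm (hm.pow_const 2)
  simp only [Pi.mul_apply, ENNReal.rpow_two] at hCS
  have h3 : ∫⁻ x, ‖v x‖ₑ ^ 3 = ∫⁻ x, ‖v x‖ₑ * ‖v x‖ₑ ^ 2 := lintegral_congr fun x => by ring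
  have h4 : ∫⁻ x, (‖v x‖ₑ ^ 2) ^ 2 = ∫⁻ x, ‖v x‖ₑ ^ 4 := lintegral_congr fun x => by ring
  have hH : (∫⁻ x, ‖v x‖ₑ ^ 4) ^ (1 / 2 : ℝ) ≤ (K : ℝ≥0∞) ^ (1 / 2 : ℝ) * (A + G) := by
    have hX : Torus.eSobolevNorm 1 (EuclideanSpace.complexify ∘ v) ^ 4 =
        (Torus.eSobolevNorm 1 (EuclideanSpace.complexify ∘ v) ^ 2) ^ 2 := by rw [← pow_mul]
    have h1 : ∫⁻ x, ‖v x‖ₑ ^ 4 ≤ K * (A + G) ^ 2 := (hK v hv).trans (by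
      rw [hX]; gcongr; exact Torus.eSobolevNorm_one_complexify_sq_le hv)
    calc (∫⁻ x, ‖v x‖ₑ ^ 4) ^ (1 / 2 : ℝ) ≤ ((K : ℝ≥0∞) * (A + G) ^ 2) ^ (1 / 2 : ℝ) := by gcongr
      _ = (K : ℝ≥0∞) ^ (1 / 2 : ℝ) * (A + G) := by
          rw [ENNReal.mul_rpow_of_nonneg _ _ (by norm_num : (0 : ℝ) ≤ 1 / 2), ← ENNReal.rpow_two,
            ← ENNReal.rpow_mul]
          norm_num
  calc ∫⁻ x, ‖v x‖ₑ ^ 3 = ∫⁻ x, ‖v x‖ₑ * ‖v x‖ₑ ^ 2 := h3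
    _ ≤ A ^ (1 / 2 : ℝ) * (∫⁻ x, (‖v x‖ₑ ^ 2) ^ 2) ^ (1 / 2 : ℝ) := hCS
    _ ≤ A ^ (1 / 2 : ℝ) * ((K : ℝ≥0∞) ^ (1 / 2 : ℝ) * (A + G)) := by rw [h4]; gcongr
    _ = (K : ℝ≥0∞) ^ (1 / 2 : ℝ) * A ^ (1 / 2 : ℝ) * (A + G) := by ring

/-- An energy-class field with finite spectral gradient norm is in `L³(T^d)` (`2 ≤ d ≤ 4`). [folklore] -/
theorem memLp_three_of_eGradNormSq_ne_top (hd2 : 2 ≤ Fintype.card d) (hd4 : Fintype.card d ≤ 4)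
    {v : UnitAddTorus d → EuclideanSpace ℝ d} (hv : MemLp v 2 volume)
    (hG : Torus.eGradNormSq v ≠ ⊤) : MemLp v 3 volume := by
  obtain ⟨K, hK⟩ := exists_lintegral_enorm_pow_three_le hd2 hd4
  have hA : ∫⁻ x, ‖v x‖ₑ ^ 2 ≠ ⊤ := by
    rw [Torus.lintegral_enorm_sq_eq_ofReal hv]; exact ENNReal.ofReal_ne_top
  refine ⟨hv.1, (eLpNorm_lt_top_iff_lintegral_rpow_enorm_lt_top three_ne_zero
    ENNReal.ofNat_ne_top).2 ?_⟩
  have h3 : ∀ a, (‖v a‖ₑ : ℝ≥0∞) ^ (3 : ℝ≥0∞).toReal = ‖v a‖ₑ ^ 3 := fun a => by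
    rw [ENNReal.toReal_ofNat, ENNReal.rpow_ofNat]
  simp_rw [h3]
  refine lt_of_le_of_lt (hK v hv) (ENNReal.mul_lt_top (ENNReal.mul_lt_top ?_ ?_) ?_)
  · exact ENNReal.rpow_lt_top_of_nonneg (by norm_num) ENNReal.coe_ne_top
  · exact ENNReal.rpow_lt_top_of_nonneg (by norm_num) hA
  · exact ENNReal.add_lt_top.2 ⟨hA.lt_top, hG.lt_top⟩

/-- **`u ∈ L³ₜL³ₓ` for torus Leray–Hopf solutions in dimension `≤ 4`, from the energy class
alone**: `∫₀ᵀ∫‖u‖³ < ∞` (slice bound `exists_lintegral_enorm_pow_three_le`, the `L^∞ₜL²ₓ` bound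
and `∫₀ᵀ‖∇u‖₂² < ∞`).  Discharges the hypothesis `hu3` of
`Torus.IsLerayHopfOn.resolvedEnergyBalance` without any Besov assumption. [folklore] -/
theorem lerayHopfOn_lintegral_enorm_pow_three_lt_top (hd2 : 2 ≤ Fintype.card d)
    (hd4 : Fintype.card d ≤ 4) {T ν : ℝ} {f u : ℝ → UnitAddTorus d → EuclideanSpace ℝ d}
    {u₀ : UnitAddTorus d → EuclideanSpace ℝ d} (h : Torus.IsLerayHopfOn T ν f u₀ u) :
    ∫⁻ t in Ioo 0 T, ∫⁻ x, ‖u t x‖ₑ ^ 3 < ⊤ := by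
  obtain ⟨K, hK⟩ := exists_lintegral_enorm_pow_three_le hd2 hd4
  obtain ⟨M, hM⟩ := h.energy_bound
  set c : ℝ≥0∞ := (K : ℝ≥0∞) ^ (1 / 2 : ℝ) * (M : ℝ≥0∞) ^ (1 / 2 : ℝ) with hc
  have hct : c < ⊤ := ENNReal.mul_lt_top
    (ENNReal.rpow_lt_top_of_nonneg (by norm_num) ENNReal.coe_ne_top)
    (ENNReal.rpow_lt_top_of_nonneg (by norm_num) ENNReal.coe_ne_top)
  have hpt : ∀ᵐ t ∂(volume.restrict (Ioo 0 T)),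
      ∫⁻ x, ‖u t x‖ₑ ^ 3 ≤ c * ((M : ℝ≥0∞) + Torus.eGradNormSq (u t)) := by
    filter_upwards [hM, ae_restrict_mem measurableSet_Ioo] with t ht htI
    calc ∫⁻ x, ‖u t x‖ₑ ^ 3
        ≤ (K : ℝ≥0∞) ^ (1 / 2 : ℝ) * (∫⁻ x, ‖u t x‖ₑ ^ 2) ^ (1 / 2 : ℝ) *
            ((∫⁻ x, ‖u t x‖ₑ ^ 2) + Torus.eGradNormSq (u t)) :=
          hK _ (h.memLp t (Ioo_subset_Icc_self htI))
      _ ≤ (K : ℝ≥0∞) ^ (1 / 2 : ℝ) * (M : ℝ≥0∞) ^ (1 / 2 : ℝ) *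
            ((M : ℝ≥0∞) + Torus.eGradNormSq (u t)) := by gcongr
  calc ∫⁻ t in Ioo 0 T, ∫⁻ x, ‖u t x‖ₑ ^ 3
      ≤ ∫⁻ t in Ioo 0 T, c * ((M : ℝ≥0∞) + Torus.eGradNormSq (u t)) := lintegral_mono_ae hpt
    _ = c * ((M : ℝ≥0∞) * volume (Ioo (0 : ℝ) T) + ∫⁻ t in Ioo 0 T, Torus.eGradNormSq (u t)) := by
        rw [lintegral_const_mul' _ _ hct.ne, lintegral_add_left measurable_const, setLIntegral_const]
    _ < ⊤ := ENNReal.mul_lt_top hct (ENNReal.add_lt_top.2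
        ⟨ENNReal.mul_lt_top ENNReal.coe_lt_top measure_Ioo_lt_top, h.lintegral_eGradNormSq_lt_top⟩)

/-- **The time-integrated flux against the third-order structure function**: if the CCFS local
flux estimate holds with constant `C` (`Torus.abs_cetFlux_le_eLocDiffModulus_holds`), then along
a torus Leray–Hopf solution (`2 ≤ d ≤ 4`), for `0 < ℓ ≤ 1/4`,
`∫₀ᵀ |Π_{K_ℓ}[u(s)]| ds ≤ C ∫₀ᵀ ω(u(s); ℓ)³ ds` in `[0, ∞]` (a.e. slice `u(s) ∈ L³` is weakly
divergence free; `memLp_three_of_eGradNormSq_ne_top`). [cite: CCFS2008, §3.2 (13)–(18)] -/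
theorem lerayHopfOn_ofReal_integral_abs_cetFlux_le (hd2 : 2 ≤ Fintype.card d)
    (hd4 : Fintype.card d ≤ 4) {C : ℝ≥0}
    (hC : ∀ {v : UnitAddTorus d → EuclideanSpace ℝ d} (_ : MemLp v 3 volume)
      (_ : Torus.IsWeaklyDivFree v) {ε : ℝ} (_ : 0 < ε) (_ : ε ≤ 1 / 4),
      ENNReal.ofReal |Torus.cetFlux (Torus.kernel ε) v| ≤ C * eLocDiffModulus (1 / 3) 3 v volume ε ^ 3)
    {T ν ℓ : ℝ} {f u : ℝ → UnitAddTorus d → EuclideanSpace ℝ d}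
    {u₀ : UnitAddTorus d → EuclideanSpace ℝ d} (h : Torus.IsLerayHopfOn T ν f u₀ u)
    (hℓ : 0 < ℓ) (hℓ' : ℓ ≤ 1 / 4)
    (hI : IntegrableOn (fun s => Torus.cetFlux (Torus.kernel ℓ) (u s)) (Ioo 0 T)) :
    ENNReal.ofReal (∫ s in Ioo 0 T, |Torus.cetFlux (Torus.kernel ℓ) (u s)|) ≤
      C * ∫⁻ s in Ioo 0 T, eLocDiffModulus (1 / 3) 3 (u s) volume ℓ ^ 3 := by
  have hG : ∀ᵐ s ∂(volume.restrict (Ioo 0 T)), Torus.eGradNormSq (u s) < ⊤ :=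
    ae_lt_top' h.aemeasurable_eGradNormSq h.lintegral_eGradNormSq_lt_top.ne
  rw [ofReal_integral_eq_lintegral_ofReal hI.abs (Eventually.of_forall fun s => abs_nonneg _),
    ← lintegral_const_mul' _ _ ENNReal.coe_ne_top]
  refine lintegral_mono_ae ?_
  filter_upwards [hG, h.weak.2.2.1, ae_restrict_mem measurableSet_Ioo] with s hs hdiv hsI
  exact hC (memLp_three_of_eGradNormSq_ne_top hd2 hd4 (h.memLp s (Ioo_subset_Icc_self hsI)) hs.ne)
    hdiv hℓ hℓ'

/-! ## The window inequality at a fixed scale -/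

/-- **Resolved-energy window inequality at a fixed scale, energy class only.** For a Leray–Hopf
solution on `T^d × [0,T]` (`2 ≤ d ≤ 4`) with viscosity `ν > 0`, solenoidal `L²` force whose
`L²` translation modulus at scale `ℓ` is at most `A_f < ∞`, datum `u₀ ∈ L²`, every
`0 < ℓ ≤ 1/4` and every `λ > 0`:
`ν∫₀ᵀ‖∇u‖₂² ≤ E(u₀) + ∫₀ᵀ|Π_{K_ℓ}[u]| + (ν·4d²C₁²/ℓ² + 2dA_f/λ) ∫₀ᵀ‖u‖₂² + 2dA_f λ T`
(`Torus.IsLerayHopfOn.dissipation_le_of_resolvedEnergyBalance` with the data cumulant dropped,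
`‖∇ū_ℓ‖₂² ≤ d²(C₁/ℓ)²(2‖u‖₂)²`, and the force cumulant `≤ 4dA_f‖u‖₂ ≤ 2dA_f(λ + ‖u‖₂²/λ)`);
the flux is also integrable in time. [cite: DrivasEyink2019, §2, proof of Lemma 1] -/
theorem lerayHopfOn_dissipation_le_fixedScale (hd2 : 2 ≤ Fintype.card d) (hd4 : Fintype.card d ≤ 4)
    {T ν ℓ lam : ℝ} {f u : ℝ → UnitAddTorus d → EuclideanSpace ℝ d}
    {u₀ : UnitAddTorus d → EuclideanSpace ℝ d} (hT : 0 < T) (hν : 0 < ν) (hℓ : 0 < ℓ)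
    (hℓ' : ℓ ≤ 1 / 4) (hlam : 0 < lam) (h : Torus.IsLerayHopfOn T ν f u₀ u)
    (hfdiv : ∀ t, Torus.IsWeaklyDivFree (f t))
    (hf_meas : AEStronglyMeasurable (Torus.stLift f) (volume.restrict (Ioo 0 T ×ˢ univ)))
    (hf2 : ∫⁻ t in Ioo 0 T, ∫⁻ x, ‖f t x‖ₑ ^ 2 < ⊤) (hfL2 : ∀ t, MemLp (f t) 2 volume)
    (hu₀ : MemLp u₀ 2 volume) {Af : ℝ≥0∞} (hAf : Af ≠ ⊤)
    (hAfy : ∀ t (y : UnitAddTorus d), ‖y‖ ≤ ℓ → eLpNorm (fun x => f t (x - y) - f t x) 2 volume ≤ Af) :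
    IntegrableOn (fun s => Torus.cetFlux (Torus.kernel ℓ) (u s)) (Ioo 0 T) ∧
    ν * (∫⁻ τ in Ioo 0 T, Torus.eGradNormSq (u τ)).toReal ≤
      Torus.kineticEnergy u₀ + (∫ s in Ioo 0 T, |Torus.cetFlux (Torus.kernel ℓ) (u s)|) +
        (ν * (4 * (Fintype.card d : ℝ) ^ 2 * Torus.gradProfileMass d ^ 2 / ℓ ^ 2) +
            2 * Fintype.card d * Af.toReal / lam) * (∫ s in Ioo 0 T, ∫ x, ‖u s x‖ ^ 2) +
        2 * Fintype.card d * Af.toReal * lam * T := by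
  haveI : IsFiniteMeasure (volume.restrict (Ioo (0 : ℝ) T)) :=
    isFiniteMeasure_restrict.mpr measure_Ioo_lt_top.ne
  set K := Torus.kernel (d := d) ℓ with hKdef
  have hum : AEStronglyMeasurable (uncurry u) ((volume.restrict (Ioo 0 T)).prod volume) :=
    Torus.aestronglyMeasurable_uncurry_restrict_prod_of_stLift h.weak.1
  have hfm : AEStronglyMeasurable (uncurry f) ((volume.restrict (Ioo 0 T)).prod volume) :=
    Torus.aestronglyMeasurable_uncurry_restrict_prod_of_stLift hf_meas
  have hu3 := lerayHopfOn_lintegral_enorm_pow_three_lt_top hd2 hd4 h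
  have hu2 : ∫⁻ t in Ioo 0 T, ∫⁻ x, ‖u t x‖ₑ ^ 2 < ⊤ := h.weak.2.1
  have hconv : Torus.kineticEnergy (Torus.vecConv (u T) K) ≤ Torus.kineticEnergy (u T) :=
    Torus.kineticEnergy_vecConv_kernel_le (h.memLp T ⟨hT.le, le_rfl⟩) hℓ hℓ'
  have hA : Torus.IsLerayHopfOn.resolvedEnergyBalance (d := d) :=
    Torus.IsLerayHopfOn.resolvedEnergyBalance_holds
  have main := Torus.IsLerayHopfOn.dissipation_le_of_resolvedEnergyBalance hA hν h hT hfdiv hf_meas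
    hf2 hu₀ hu3 hℓ hℓ' hconv
  obtain ⟨hIflux, hIg, hIB, -⟩ := hA hν h hfdiv hf_meas hf2 hu₀ hu3 hℓ hℓ'
  refine ⟨hIflux, ?_⟩
  set D : ℝ := (Fintype.card d : ℝ) with hD
  set C₁ : ℝ := Torus.gradProfileMass d with hC₁
  set W : ℝ → ℝ := fun s => ∫ x, ‖u s x‖ ^ 2 with hW
  set Ar : ℝ := Af.toReal with hAr
  have hC₁0 : 0 ≤ C₁ := Torus.gradProfileMass_nonneg (d := d)
  have hD0 : 0 ≤ D := Nat.cast_nonneg _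
  have hAr0 : 0 ≤ Ar := ENNReal.toReal_nonneg
  have hlam0 : lam ≠ 0 := hlam.ne'
  have hℓ0 : ℓ ≠ 0 := hℓ.ne'
  have hWi : IntegrableOn W (Ioo 0 T) := h.integrableOn_integral_norm_sq
  -- slice facts on `(0, T)`
  have hmem : ∀ s ∈ Ioo 0 T, MemLp (u s) 2 volume := fun s hs => h.memLp s (Ioo_subset_Icc_self hs)
  have hAu : ∀ s ∈ Ioo 0 T, ∀ y : UnitAddTorus d, ‖y‖ ≤ ℓ →
      eLpNorm (fun x => u s (x - y) - u s x) 2 volume ≤ 2 * eLpNorm (u s) 2 volume :=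
    fun s hs y _ => eLpNorm_shift_sub_le one_le_two (hmem s hs).1 y
  have hAut : ∀ s ∈ Ioo 0 T, 2 * eLpNorm (u s) 2 volume ≠ ⊤ := fun s hs =>
    ENNReal.mul_ne_top ENNReal.ofNat_ne_top (hmem s hs).2.ne
  have htoR : ∀ s ∈ Ioo 0 T, (2 * eLpNorm (u s) 2 volume).toReal = 2 * (eLpNorm (u s) 2 volume).toReal :=
    fun s hs => by rw [ENNReal.toReal_mul, ENNReal.toReal_ofNat]
  have hL2 : ∀ s ∈ Ioo 0 T, (eLpNorm (u s) 2 volume).toReal ^ 2 = W s := fun s hs => by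
    have := Torus.kineticEnergy_eq_of_memLp (hmem s hs)
    unfold FunctionSpaces.Torus.kineticEnergy at this
    simp only [hW]; linarith
  -- T2: flux
  have hT2 : -(∫ s in Ioo 0 T, Torus.cetFlux K (u s)) ≤ ∫ s in Ioo 0 T, |Torus.cetFlux K (u s)| :=
    (neg_le_abs _).trans abs_integral_le_integral_abs
  -- T3: resolved dissipation
  have hT3s : ∀ s ∈ Ioo 0 T, Torus.gradNormSq (Torus.vecConv (u s) K) ≤ 4 * D ^ 2 * C₁ ^ 2 / ℓ ^ 2 * W s := by
    intro s hs
    have h1 := Torus.gradNormSq_vecConv_kernel_le ((hmem s hs).integrable one_le_two) hℓ hℓ' (hAut s hs) (hAu s hs)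
    rw [htoR s hs] at h1
    calc _ ≤ D ^ 2 * ((ℓ⁻¹ * C₁) * (2 * (eLpNorm (u s) 2 volume).toReal)) ^ 2 := h1
      _ = 4 * D ^ 2 * C₁ ^ 2 / ℓ ^ 2 * (eLpNorm (u s) 2 volume).toReal ^ 2 := by field_simp; ring
      _ = 4 * D ^ 2 * C₁ ^ 2 / ℓ ^ 2 * W s := by rw [hL2 s hs]
  have hT3 : ν * (∫ s in Ioo 0 T, Torus.gradNormSq (Torus.vecConv (u s) K)) ≤
      ν * (4 * D ^ 2 * C₁ ^ 2 / ℓ ^ 2 * ∫ s in Ioo 0 T, W s) := by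
    refine mul_le_mul_of_nonneg_left ?_ hν.le
    rw [← integral_const_mul]
    exact setIntegral_mono_on hIg (hWi.const_mul _) measurableSet_Ioo hT3s
  -- T4: force cumulant
  have hIA : IntegrableOn (fun s => ∫ x, ⟪f s x, u s x⟫) (Ioo 0 T) :=
    Torus.integrableOn_integral_inner_of_sq hfm hum hf2 hu2
  have hint : (∫ τ in (0 : ℝ)..T, ∫ x, ⟪f τ x, u τ x⟫) = ∫ s in Ioo 0 T, ∫ x, ⟪f s x, u s x⟫ := by
    rw [intervalIntegral.integral_of_le hT.le, integral_Ioc_eq_integral_Ioo]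
  have hT4s : ∀ s ∈ Ioo 0 T, (∫ x, ⟪f s x, u s x⟫) - (∫ x, ⟪Torus.vecConv (f s) K x, Torus.vecConv (u s) K x⟫) ≤
      2 * D * Ar * lam + 2 * D * Ar / lam * W s := by
    intro s hs
    have h1 := Torus.abs_integral_inner_sub_integral_inner_vecConv_le (hfL2 s) (hmem s hs) hℓ hℓ' hAf
      (hAut s hs) (hAfy s) (hAu s hs)
    rw [htoR s hs] at h1
    set X : ℝ := (eLpNorm (u s) 2 volume).toReal with hX
    have hX2 : X ^ 2 = W s := hL2 s hs
    have hkey : D * (2 * Ar * (2 * X)) ≤ 2 * D * Ar * lam + 2 * D * Ar / lam * X ^ 2 := by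
      have h0 : 0 ≤ 2 * D * Ar / lam * (X - lam) ^ 2 := by positivity
      have : 2 * D * Ar * lam + 2 * D * Ar / lam * X ^ 2 - D * (2 * Ar * (2 * X)) =
          2 * D * Ar / lam * (X - lam) ^ 2 := by field_simp; ring
      linarith
    rw [hX2] at hkey
    exact (le_abs_self _).trans (h1.trans hkey)
  have hT4 : (∫ s in Ioo 0 T, ∫ x, ⟪f s x, u s x⟫) -
      (∫ s in Ioo 0 T, ∫ x, ⟪Torus.vecConv (f s) K x, Torus.vecConv (u s) K x⟫) ≤
      2 * D * Ar * lam * T + 2 * D * Ar / lam * ∫ s in Ioo 0 T, W s := by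
    rw [← integral_sub hIA hIB]
    have hrhs : ∫ s in Ioo 0 T, (2 * D * Ar * lam + 2 * D * Ar / lam * W s) =
        2 * D * Ar * lam * T + 2 * D * Ar / lam * ∫ s in Ioo 0 T, W s := by
      rw [integral_add (integrable_const _) (hWi.const_mul _), integral_const_mul, integral_const_mul,
        setIntegral_const, Real.volume_real_Ioo_of_le hT.le, sub_zero, smul_eq_mul]
      ring
    rw [← hrhs]
    exact setIntegral_mono_on (hIA.sub hIB) ((integrable_const _).add (hWi.const_mul _))
      measurableSet_Ioo hT4s
  have hT1 : Torus.kineticEnergy u₀ - Torus.kineticEnergy (Torus.vecConv u₀ K) ≤ Torus.kineticEnergy u₀ := by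
    linarith [Torus.kineticEnergy_nonneg (Torus.vecConv u₀ K)]
  rw [hint] at main
  have hsplit : (ν * (4 * D ^ 2 * C₁ ^ 2 / ℓ ^ 2) + 2 * D * Ar / lam) * (∫ s in Ioo 0 T, W s) =
      ν * (4 * D ^ 2 * C₁ ^ 2 / ℓ ^ 2 * ∫ s in Ioo 0 T, W s) + 2 * D * Ar / lam * ∫ s in Ioo 0 T, W s := by
    ring
  rw [hsplit]
  linarith

end Summit.AnomalousDissipation.AnomalousDissipation.Theorems
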